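import Summits.RiemannHypothesis.RiemannHypothesis.Theorems.WeilTwoPrimeDeflE25OBase
import Summits.RiemannHypothesis.RiemannHypothesis.Theorems.WeilTwoPrimeDeflE25ODataPO29
import Literature.NumberTheory.LFunctions.WeilBlockRowsPZ
import Literature.NumberTheory.LFunctions.WeilBlockRowsFast
import Summits.RiemannHypothesis.RiemannHypothesis.Theorems.WeilLegendreBlocks136DataDn14
import HarnessLib

/-!
# Deflated two-prime certificate E25O: dominance of row 83 of `R = S''_odd(κ') − UᵀU` (factored data)

`WeilCert.checkDomRowPZ` with the materialized augmented block, the factored inverse `weilBlocks136Dn/weilBlocks136Ls` and the Bessel block, by `decide +kernel` row by row. Pure proof file.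
-/

set_option linter.dupNamespace false

noncomputable section

namespace Summit.RiemannHypothesis.RiemannHypothesis.Theorems.EvenWinsBeyondArch

open Literature.NumberTheory.LFunctions

set_option maxHeartbeats 0 in
/-- Kernel check of the dominance of row 83 of `R` (odd block, certificate E25O). [folklore] -/
theorem checkDomRowF1_83_weilCertDeflE25O :
    weilCertDeflE25OBase.checkDomRowF weilCertDeflE25OPmO weilBlocks136Dn weilBlocks136Ls weilCertDeflE25OHpO weilCertDeflE25OKappa' 1 83 = true := by
  decide +kernel

/-- Kernel check of the dominance of row 83 of `R` (factored data), from the fast row. [folklore] -/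
theorem checkDomRowPZ1_83_weilCertDeflE25O :
    weilCertDeflE25OBase.checkDomRowPZ weilCertDeflE25OPmO weilBlocks136Dn weilBlocks136Ls weilCertDeflE25OHpO weilCertDeflE25OKappa' 1 83 = true :=
  WeilCert.checkDomRowPZ_of_F (by decide) checkDomRowF1_83_weilCertDeflE25O

end Summit.RiemannHypothesis.RiemannHypothesis.Theorems.EvenWinsBeyondArch
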